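import Mathlib
import Summits.ResolutionOfSingularities.ResolutionOfSingularities.Theorems.WildQuotientsWildQuotientResolutionQuarter1123WeightZero
import Summits.ResolutionOfSingularities.ResolutionOfSingularities.Theorems.WildQuotientsWildQuotientResolutionQuarter1123Defs
import Summits.ResolutionOfSingularities.ResolutionOfSingularities.Theorems.WildQuotientsWildQuotientResolutionToricChartLemmas

/-!
# RUNG V5 (`J₅`), brick `HP₀` ring side — the slot renaming `(s,t,u,v,P) ↦ (x_{a'},x_{b'},x_{c'},x_{d'}, passengers)`

(crux stmt-ResolutionOfSingularities-15640 `WildQuotients.WildQuotientResolution`, line `Sketch`;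
chain w45c RUNG V5, tools for `JordanFive.exists_ringBrick_X0_model` (res-L1-w45c-plan-1 ORDERS
2026-08-27T12:39:07Z; prover res-L1-w45c-stub-2). [OURS · L1 W4.5c] — NOT a statement of any
manuscript; replaces the role of no printed item. Def-free.)

The cone symbols of res-L1-w45c-stub-4's presented ring `ToricChart.Ring k P Quarter1123.quarterDatum`
(`¼(1,1,2,3) × 𝔸^P`, p527204) live in `k[Fin 4 ⊕ P]`; the `μ₄` root chart is `k[Fin n]` with slots
`a, b, c, d` and passengers `P = {i // i ∉ {a,b,c,d}}`. The SLOT RENAMING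
`slot = Sum.elim ![a', b', c', d'] Subtype.val : Fin 4 ⊕ P → Fin n` for a permutation `(a',b',c',d')` of
`(a,b,c,d)` (namely `(a,b,c,d)` for `p ≡ 1`, `(b,d,c,a)` for `p ≡ 3 (mod 4)`):

* `algebra_isIntegral_of_weight_four` — `k[x]` is integral over the weight-`0` subalgebra of any
  `ZMod 4`-valued weight (`xᵢ⁴` has weight `0`);
* `slot_injective`;
* `X_image_preimage_slot_three`, `X_image_preimage_slot_univ` — `slot⁻¹{a,b,d} = {s,t,v}` (when
  `{a',b',d'} = {a,b,d}`) and `slot⁻¹{a,b,c,d} = {s,t,u,v}`, as images of variables;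
* `rename_presentation_X_inl_inl / _inl_inr / _inr` — the generators of the renamed presentation;
* **`mem_range_rename_theta_iff`** — the image of `rename slot ∘ θ` is the weight-`0` part of the cone
  weight `w' : (a',b',c',d') ↦ (1,1,2,3)` (res-type-036's
  `Quarter1123.mem_adjoin_iff_isWeightedHomogeneous_zero`, p526564).
-/

-- single-problem summit: the doubled namespace component `ResolutionOfSingularities` is forced
set_option linter.dupNamespace false

noncomputable section

open MvPolynomial

namespace Summit.ResolutionOfSingularities.ResolutionOfSingularities.Theorems.WildQuotientResolution.JordanFive

/-- **`k[x₁,…,xₙ]` is integral over the weight-`0` subalgebra of a `ZMod 4`-valued weight**: every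
`xᵢ⁴` has weight `4 • w i = 0`. [folklore] -/
theorem algebra_isIntegral_of_weight_four (k : Type) [Field k] (n : ℕ) (w : Fin n → ZMod 4)
    (E : Subalgebra k (MvPolynomial (Fin n) k)) (hE : ∀ f, f ∈ E ↔ IsWeightedHomogeneous w f 0) :
    Algebra.IsIntegral E (MvPolynomial (Fin n) k) := by
  refine ⟨fun x => ?_⟩
  have hmemE : ∀ {y : MvPolynomial (Fin n) k} (hy : y ∈ E), IsIntegral E y := fun {y} hy =>
    (isIntegral_algebraMap (R := E) (A := MvPolynomial (Fin n) k) (x := ⟨y, hy⟩))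
  have hX : ∀ i : Fin n, IsIntegral E (X i : MvPolynomial (Fin n) k) := by
    intro i
    refine IsIntegral.of_pow (by norm_num : 0 < 4) (hmemE ((hE _).mpr ?_))
    have h := (isWeightedHomogeneous_X k w i).pow 4
    have h4 : (4 : ℕ) • w i = 0 := by
      rw [nsmul_eq_mul]; exact mul_eq_zero_of_left (by decide) _
    rwa [h4] at h
  induction x using MvPolynomial.induction_on with
  | C r =>
      have : (C r : MvPolynomial (Fin n) k) = algebraMap k (MvPolynomial (Fin n) k) r := rfl
      rw [this]
      exact hmemE (Subalgebra.algebraMap_mem E r)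
  | add p q hp hq => exact hp.add hq
  | mul_X p i hp => exact hp.mul (hX i)


variable (k : Type) [Field k] (n : ℕ) (a b c d a' b' c' d' : Fin n)

/-- The passenger index type. -/
local notation3 "Psg" => {i : Fin n // i ≠ a ∧ i ≠ b ∧ i ≠ c ∧ i ≠ d}
/-- The slot renaming. -/
local notation3 "slot" => (Sum.elim ![a', b', c', d'] (Subtype.val : Psg → Fin n) : Fin 4 ⊕ Psg → Fin n)

/-- The slot renaming is injective (distinct slots, passengers off the slots). [OURS · L1 W4.5c] -/
theorem slot_injective (hon : ∀ q : Psg, q.1 ≠ a' ∧ q.1 ≠ b' ∧ q.1 ≠ c' ∧ q.1 ≠ d') (h'ab : a' ≠ b') (h'ac : a' ≠ c') (h'ad : a' ≠ d') (h'bc : b' ≠ c')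
    (h'bd : b' ≠ d') (h'cd : c' ≠ d') : Function.Injective slot := by
  have hsl0 : slot (Sum.inl 0) = a' := rfl
  have hsl1 : slot (Sum.inl 1) = b' := rfl
  have hsl2 : slot (Sum.inl 2) = c' := rfl
  have hsl3 : slot (Sum.inl 3) = d' := rfl
  have hslq : ∀ q : Psg, slot (Sum.inr q) = q.1 := fun q => rfl
  rintro (s | q) (s' | q') h
  · fin_cases s <;> fin_cases s' <;> simp_all
  · exfalso
    obtain ⟨h₁, h₂, h₃, h₄⟩ := hon q'
    rw [hslq] at h
    fin_cases s
    · exact h₁ (h ▸ hsl0)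
    · exact h₂ (h ▸ hsl1)
    · exact h₃ (h ▸ hsl2)
    · exact h₄ (h ▸ hsl3)
  · exfalso
    obtain ⟨h₁, h₂, h₃, h₄⟩ := hon q
    rw [hslq] at h
    fin_cases s'
    · exact h₁ (h.symm ▸ hsl0)
    · exact h₂ (h.symm ▸ hsl1)
    · exact h₃ (h.symm ▸ hsl2)
    · exact h₄ (h.symm ▸ hsl3)
  · rw [hslq, hslq] at h
    rw [Subtype.ext h]

/-- `X '' (slot⁻¹ {a,b,d}) = {X s, X t, X v}` when `{a',b',d'} = {a,b,d}` and `c' ∉ {a',b',d'}`.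
[OURS · L1 W4.5c] -/
theorem X_image_preimage_slot_three (hon : ∀ q : Psg, q.1 ≠ a' ∧ q.1 ≠ b' ∧ q.1 ≠ c' ∧ q.1 ≠ d')
    (h'ac : a' ≠ c') (h'bc : b' ≠ c') (h'cd : c' ≠ d')
    (hS3 : ∀ i, (i = a' ∨ i = b' ∨ i = d') ↔ (i = a ∨ i = b ∨ i = d)) :
    X '' (slot ⁻¹' ({a, b, d} : Set (Fin n))) =
      (fun s : Fin 4 => (X (Sum.inl s) : MvPolynomial (Fin 4 ⊕ Psg) k)) ''
        (({0, 1, 3} : Finset (Fin 4)) : Set (Fin 4)) := by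
  have hsl0 : slot (Sum.inl 0) = a' := rfl
  have hsl1 : slot (Sum.inl 1) = b' := rfl
  have hsl3 : slot (Sum.inl 3) = d' := rfl
  have hslq : ∀ q : Psg, slot (Sum.inr q) = q.1 := fun q => rfl
  ext g
  constructor
  · rintro ⟨v, hv, rfl⟩
    rw [Set.mem_preimage] at hv
    have hv' : slot v = a' ∨ slot v = b' ∨ slot v = d' := by
      rw [hS3]; simpa only [Set.mem_insert_iff, Set.mem_singleton_iff] using hv
    rcases v with s | q
    · refine ⟨s, ?_, rfl⟩
      fin_cases s
      · simp
      · simp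
      · exfalso
        change c' = a' ∨ c' = b' ∨ c' = d' at hv'
        rcases hv' with h | h | h
        · exact h'ac h.symm
        · exact h'bc h.symm
        · exact h'cd h
      · simp
    · exfalso
      obtain ⟨h₁, h₂, -, h₄⟩ := hon q
      rw [hslq] at hv'
      rcases hv' with h | h | h
      · exact h₁ h
      · exact h₂ h
      · exact h₄ h
  · rintro ⟨s, hs, rfl⟩
    refine ⟨Sum.inl s, ?_, rfl⟩
    rw [Set.mem_preimage]
    have : slot (Sum.inl s) = a' ∨ slot (Sum.inl s) = b' ∨ slot (Sum.inl s) = d' := by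
      simp only [Finset.coe_insert, Finset.coe_singleton, Set.mem_insert_iff, Set.mem_singleton_iff] at hs
      rcases hs with rfl | rfl | rfl
      · exact Or.inl hsl0
      · exact Or.inr (Or.inl hsl1)
      · exact Or.inr (Or.inr hsl3)
    rw [hS3] at this
    simpa only [Set.mem_insert_iff, Set.mem_singleton_iff] using this

/-- `X '' (slot⁻¹ {a,b,c,d}) = {X s, X t, X u, X v}` when `{a',b',c',d'} = {a,b,c,d}`.
[OURS · L1 W4.5c] -/
theorem X_image_preimage_slot_univ (hon : ∀ q : Psg, q.1 ≠ a' ∧ q.1 ≠ b' ∧ q.1 ≠ c' ∧ q.1 ≠ d')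
    (hS4 : ∀ i, (i = a' ∨ i = b' ∨ i = c' ∨ i = d') ↔ (i = a ∨ i = b ∨ i = c ∨ i = d)) :
    X '' (slot ⁻¹' ({a, b, c, d} : Set (Fin n))) =
      (fun s : Fin 4 => (X (Sum.inl s) : MvPolynomial (Fin 4 ⊕ Psg) k)) ''
        ((Finset.univ : Finset (Fin 4)) : Set (Fin 4)) := by
  have hsl0 : slot (Sum.inl 0) = a' := rfl
  have hsl1 : slot (Sum.inl 1) = b' := rfl
  have hsl2 : slot (Sum.inl 2) = c' := rfl
  have hsl3 : slot (Sum.inl 3) = d' := rfl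
  have hslq : ∀ q : Psg, slot (Sum.inr q) = q.1 := fun q => rfl
  ext g
  constructor
  · rintro ⟨v, hv, rfl⟩
    rw [Set.mem_preimage] at hv
    have hv' : slot v = a' ∨ slot v = b' ∨ slot v = c' ∨ slot v = d' := by
      rw [hS4]; simpa only [Set.mem_insert_iff, Set.mem_singleton_iff] using hv
    rcases v with s | q
    · exact ⟨s, by simp, rfl⟩
    · exfalso
      obtain ⟨h₁, h₂, h₃, h₄⟩ := hon q
      rw [hslq] at hv'
      rcases hv' with h | h | h | h
      · exact h₁ h
      · exact h₂ h
      · exact h₃ h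
      · exact h₄ h
  · rintro ⟨s, -, rfl⟩
    refine ⟨Sum.inl s, ?_, rfl⟩
    rw [Set.mem_preimage]
    have : slot (Sum.inl s) = a' ∨ slot (Sum.inl s) = b' ∨ slot (Sum.inl s) = c' ∨
        slot (Sum.inl s) = d' := by
      fin_cases s
      · exact Or.inl hsl0
      · exact Or.inr (Or.inl hsl1)
      · exact Or.inr (Or.inr (Or.inl hsl2))
      · exact Or.inr (Or.inr (Or.inr hsl3))
    rw [hS4] at this
    simpa only [Set.mem_insert_iff, Set.mem_singleton_iff] using this

/-- The renamed presentation on a pure symbol: `x_{slot s} ^ pw s`. [OURS · L1 W4.5c] -/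
theorem rename_presentation_X_inl_inl (s : Fin 4) :
    rename slot (ToricChart.presentation k Psg Quarter1123.quarterDatum (X (Sum.inl (Sum.inl s)))) =
      X (slot (Sum.inl s)) ^ Quarter1123.quarterDatum.pw s := by
  rw [ToricChart.presentation_X_inl_inl, map_pow, rename_X]

/-- The renamed presentation on a passenger: `x_q`. [OURS · L1 W4.5c] -/
theorem rename_presentation_X_inl_inr (q : Psg) :
    rename slot (ToricChart.presentation k Psg Quarter1123.quarterDatum (X (Sum.inl (Sum.inr q)))) = X q.1 := by
  rw [ToricChart.presentation_X_inl_inr, rename_X]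
  rfl

/-- The renamed presentation on a mixed symbol: `∏ x_{slot s} ^ mx j s`. [OURS · L1 W4.5c] -/
theorem rename_presentation_X_inr (j : Fin 9) :
    rename slot (ToricChart.presentation k Psg Quarter1123.quarterDatum (X (Sum.inr j))) =
      ∏ s : Fin 4, (X (slot (Sum.inl s)) : MvPolynomial (Fin n) k) ^ Quarter1123.quarterDatum.mx j s := by
  rw [ToricChart.presentation_X_inr, ToricChart.xmon, map_prod]
  refine Finset.prod_congr rfl fun s _ => ?_
  rw [map_pow, rename_X]

/-- The range of `rename slot ∘ θ` is generated by the renamed generators. [OURS · L1 W4.5c] -/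
theorem range_rename_comp_theta :
    ((rename slot).comp (ToricChart.theta (k := k) (P := Psg) (D := Quarter1123.quarterDatum))).range =
      Algebra.adjoin k (Set.range fun v => rename slot (ToricChart.presentation k Psg Quarter1123.quarterDatum (X v))) := by
  have hΨ : (rename slot).comp (ToricChart.presentation k Psg Quarter1123.quarterDatum) =
      aeval (fun v => rename slot (ToricChart.presentation k Psg Quarter1123.quarterDatum (X v))) :=
    MvPolynomial.algHom_ext fun v => by rw [AlgHom.comp_apply, aeval_X]
  apply le_antisymm
  · rintro _ ⟨y, rfl⟩
    obtain ⟨F, rfl⟩ := Ideal.Quotient.mk_surjective y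
    change rename slot (ToricChart.theta (Ideal.Quotient.mk _ F)) ∈ _
    rw [ToricChart.theta_mk, Algebra.adjoin_range_eq_range_aeval, ← hΨ]
    exact ⟨F, rfl⟩
  · rw [Algebra.adjoin_le_iff]
    rintro _ ⟨v, rfl⟩
    refine ⟨Ideal.Quotient.mk _ (X v), ?_⟩
    change rename slot (ToricChart.theta (Ideal.Quotient.mk _ (X v))) = _
    rw [ToricChart.theta_mk]

/-- **The image of `rename slot ∘ θ` is the weight-`0` part** of the cone weight
`w' : (a',b',c',d') ↦ (1,1,2,3)`, `0` elsewhere (the thirteen Hilbert monomials and the passengers are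
among the renamed generators; res-type-036's «any subalgebra» lemma). [OURS · L1 W4.5c] -/
theorem mem_range_rename_theta_iff (hon : ∀ q : Psg, q.1 ≠ a' ∧ q.1 ≠ b' ∧ q.1 ≠ c' ∧ q.1 ≠ d')
    (h'ab : a' ≠ b') (h'ac : a' ≠ c') (h'ad : a' ≠ d') (h'bc : b' ≠ c')
    (h'bd : b' ≠ d') (h'cd : c' ≠ d')
    (hoff : ∀ i, i ≠ a' → i ≠ b' → i ≠ c' → i ≠ d' → (i ≠ a ∧ i ≠ b ∧ i ≠ c ∧ i ≠ d))
    (w' : Fin n → ZMod 4) (h0 : w' a' = 1) (h1 : w' b' = 1) (h2 : w' c' = 2) (h3 : w' d' = 3)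
    (hw'0 : ∀ i, i ≠ a' → i ≠ b' → i ≠ c' → i ≠ d' → w' i = 0) (Q : MvPolynomial (Fin n) k) :
    Q ∈ ((rename slot).comp (ToricChart.theta (k := k) (P := Psg) (D := Quarter1123.quarterDatum))).range ↔
      IsWeightedHomogeneous w' Q 0 := by
  have hsl0 : slot (Sum.inl 0) = a' := rfl
  have hsl1 : slot (Sum.inl 1) = b' := rfl
  have hsl2 : slot (Sum.inl 2) = c' := rfl
  have hsl3 : slot (Sum.inl 3) = d' := rfl
  have hw'q : ∀ q : Psg, w' q.1 = 0 := fun q =>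
    hw'0 _ (hon q).1 (hon q).2.1 (hon q).2.2.1 (hon q).2.2.2
  rw [range_rename_comp_theta]
  have hG' : ∀ v, rename slot (ToricChart.presentation k Psg Quarter1123.quarterDatum (X v)) ∈ Algebra.adjoin k
      (Set.range fun v => rename slot (ToricChart.presentation k Psg Quarter1123.quarterDatum (X v))) :=
    fun v => Algebra.subset_adjoin ⟨v, rfl⟩
  have hm : ∀ j : Fin 9, (∏ s : Fin 4, (X (slot (Sum.inl s)) : MvPolynomial (Fin n) k) ^ Quarter1123.quarterDatum.mx j s) ∈
      Algebra.adjoin k (Set.range fun v => rename slot (ToricChart.presentation k Psg Quarter1123.quarterDatum (X v))) :=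
    fun j => by rw [← rename_presentation_X_inr]; exact hG' _
  have hpu : ∀ s : Fin 4, ((X (slot (Sum.inl s)) : MvPolynomial (Fin n) k) ^ Quarter1123.quarterDatum.pw s) ∈
      Algebra.adjoin k (Set.range fun v => rename slot (ToricChart.presentation k Psg Quarter1123.quarterDatum (X v))) :=
    fun s => by rw [← rename_presentation_X_inl_inl]; exact hG' _
  refine Quarter1123.mem_adjoin_iff_isWeightedHomogeneous_zero w' h0 h1 h2 h3 hw'0 h'ab h'ac h'ad
    h'bc h'bd h'cd _ ?_ ?_ ?_ ?_ ?_ ?_ ?_ ?_ ?_ ?_ ?_ ?_ ?_ ?_ ?_ Q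
  · rintro _ ⟨v, rfl⟩
    dsimp only
    rcases v with ((s | q) | j)
    · rw [rename_presentation_X_inl_inl]
      have h := (isWeightedHomogeneous_X k w' (slot (Sum.inl s))).pow (Quarter1123.quarterDatum.pw s)
      have hdeg : Quarter1123.quarterDatum.pw s • w' (slot (Sum.inl s)) = 0 := by
        fin_cases s <;> simp +decide [h0, h1, h2, h3, Quarter1123.quarterDatum]
      rwa [hdeg] at h
    · rw [rename_presentation_X_inl_inr]
      have h := isWeightedHomogeneous_X k w' q.1
      rwa [hw'q] at h
    · rw [rename_presentation_X_inr]
      have h := IsWeightedHomogeneous.prod (w := w') Finset.univ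
        (fun s : Fin 4 => (X (slot (Sum.inl s)) : MvPolynomial (Fin n) k) ^ Quarter1123.quarterDatum.mx j s)
        (fun s => Quarter1123.quarterDatum.mx j s • w' (slot (Sum.inl s)))
        (fun s _ => (isWeightedHomogeneous_X k w' _).pow _)
      have hdeg : ∑ s : Fin 4, Quarter1123.quarterDatum.mx j s • w' (slot (Sum.inl s)) = 0 := by
        fin_cases j <;>
          simp +decide [Fin.sum_univ_four, h0, h1, h2, h3, Quarter1123.quarterDatum]
      rwa [hdeg] at h
  · simpa [Quarter1123.quarterDatum] using hpu 0
  · simpa [Fin.prod_univ_four, Quarter1123.quarterDatum] using hm 0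
  · simpa [Fin.prod_univ_four, Quarter1123.quarterDatum] using hm 1
  · simpa [Fin.prod_univ_four, Quarter1123.quarterDatum] using hm 2
  · simpa [Quarter1123.quarterDatum] using hpu 1
  · simpa [Fin.prod_univ_four, Quarter1123.quarterDatum] using hm 3
  · simpa [Fin.prod_univ_four, Quarter1123.quarterDatum] using hm 4
  · simpa [Fin.prod_univ_four, Quarter1123.quarterDatum] using hm 5
  · simpa [Quarter1123.quarterDatum] using hpu 2
  · simpa [Fin.prod_univ_four, Quarter1123.quarterDatum] using hm 6
  · simpa [Fin.prod_univ_four, Quarter1123.quarterDatum] using hm 7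
  · simpa [Fin.prod_univ_four, Quarter1123.quarterDatum] using hm 8
  · simpa [Quarter1123.quarterDatum] using hpu 3
  · intro i h₁ h₂ h₃ h₄
    have h := rename_presentation_X_inl_inr k n a b c d a' b' c' d' ⟨i, hoff i h₁ h₂ h₃ h₄⟩
    rw [← h]; exact hG' _

end Summit.ResolutionOfSingularities.ResolutionOfSingularities.Theorems.WildQuotientResolution.JordanFive

end
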